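import Summits.BirchSwinnertonDyer.BirchSwinnertonDyer.Theorems.ManinLocalTwoThreeCubeLawCubeCriterion
import HarnessLib

/-!
# `3`-blindness: at `3 ∤ c` the cube condition on `Θ_T` is an intrinsic, `c`-free property of the `3`-torsion point

Summit `BirchSwinnertonDyer`, route `ManinLocalTwoThree` (cell bsd-f2-manin), crux C3 `ManinPrimeToThreeAtNine`
(stmt-BirchSwinnertonDyer-22968), line `kato_shift_three` (v8 of record), stub 4 = LAW₃
`CuspidalKummerThree.CuspidalKummerCubeExponentLaw`.  The sibling file `…CubeLawCubeCriterion` (lead p1 g5) showed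
LAW₃ ⟺ NOCUBE₃ («`Θ_T` is never a cube in `Frac ℤ₃⟦q⟧`») modulo K_geo₃.  THIS FILE splits NOCUBE₃:

* §1–§2 `kummerCubeSeries_eq_subst_intrinsic` — `Θ_T(z) = Θ♮(c·z)`, `Θ♮ := kummerCubeSeries W 1 (X₀/c²) (Y₀/c³) X` the
  series of `T♮ = (X₀/c², Y₀/c³)` on `E♮ = E_{W,1}` in its formal parameter (a `c`-free object);
* §3 `isThreeAdicFracCube_subst_iff` — «cube in `Frac ℤ₃⟦q⟧`» is invariant under substituting a `3`-integral series
  with zero constant term and UNIT linear coefficient (compositional inverse `substInvOfIsUnit`);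
* §4 `exists_padicInt_scaled_germ_of_not_three_dvd` — for `9 ∣ N` and `3 ∤ c`, `c·z = exp_{E♮}(c·Σaₙqⁿ/n)` is such a
  series (`a_{3m} = 0`, `exp_{E♮} ∈ ℤ₃⟦T⟧` by p3's `exists_padicInt_shortModel_three`; linear coefficient `c`);
* §5 `isThreeAdicFracCube_kummerCubeSeries_iff_intrinsic` — hence at `3 ∤ c`: `Θ_T` is a `3`-adic cube iff `T` is
  **`3`-BLIND** := `IsThreeAdicFracCube (kummerCubeSeries W 1 X₁ Y₁ X)` (existing vocabulary, nothing new declared);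
* §6 consequences: `exists_not_three_dvd_of_not_threeBlind` (HONESTY at `3 ∤ c`, non-blind `T` — the `p = 3` twin of
  p1-g4's `cuspidalKummerOddExponent_of_maninOddOfReducibleAtFour`), `forall_three_dvd_of_threeBlind`,
  `cuspidalKummerCubeExponentLaw_of_noBlind_of_locus` (**LAW₃ ⟸ NB₃ ∧ C3-on-the-locus**) and
  `noBlind_of_cuspidalKummerCubeExponentLaw_of_representative` (**LAW₃ ∧ K_geo₃ ⟹ NB₃**), where NB₃ (inline, `c`-free)
  := no `X₀(N)`-optimal `W` with `9 ∣ N` carries a `3`-blind rational point of order `3`.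

READING (lead's census, work/explore/ + cell table data/FHEIGHT-rows-v1): blind ⟺ the rational-kernel `3`-isogeny
`W → W/⟨T⟩` lowers the Faltings height; it happens on NON-optimal curves (27a4, `T = (3,0)`), never from an optimal
curve at additive `3` for `N < 5·10⁵` — NB₃ is a Stevens-type OPTIMALITY law, the honest open content of stub 4 being
NB₃ ∧ (C3 on the rational-`3`-torsion locus).  CONDITIONAL edges only; nothing about BSD or Manin's conjecture is proved.
-/

set_option autoImplicit false
set_option linter.dupNamespace false

noncomputable section

open scoped Classical
open PowerSeries WeierstrassCurve Literature.NumberTheory.EllipticCurves Literature.NumberTheory.EllipticCurves.ModularForms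
  Literature.RingTheory.FormalGroups
open Summit.BirchSwinnertonDyer.Rank1Residual.ManinAdditive.CuspidalKummer
  Summit.BirchSwinnertonDyer.Rank1Residual.ManinAdditive.CuspidalKummerThree

namespace Summit.BirchSwinnertonDyer.BirchSwinnertonDyer.Theorems.ManinLocalTwoThree

/-! ### §1 The short models `E_{W,c}` and `E♮ = E_{W,1}`: discriminant, `3`-division polynomial, slope, torsion -/

/-- `Δ(E_{W,c}) = c¹² Δ(W)`. [Silverman AEC III.1, Table 3.1] [folklore] -/
theorem shortModel_Δ (W : WeierstrassCurve ℚ) (c : ℤ) : (shortModel W c).Δ = (c : ℚ) ^ 12 * W.Δ := by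
  have hc := W.c_relation
  simp only [shortModel, WeierstrassCurve.Δ, WeierstrassCurve.b₂, WeierstrassCurve.b₄, WeierstrassCurve.b₆,
    WeierstrassCurve.b₈] at hc ⊢
  simp only [WeierstrassCurve.c₄, WeierstrassCurve.c₆, WeierstrassCurve.b₂, WeierstrassCurve.b₄,
    WeierstrassCurve.b₆] at hc ⊢
  linear_combination ((c : ℚ) ^ 12 / 1728) * hc

/-- On `E_{W,c}` (`a₁ = a₂ = a₃ = 0`), `Ψ₃ = 3x⁴ + 6a₄x² + 12a₆x − a₄²`. [Silverman AEC Exercise 3.7] [folklore] -/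
theorem isRoot_Ψ₃_shortModel_iff (W : WeierstrassCurve ℚ) (c : ℤ) (X₀ : ℚ) :
    (shortModel W c).Ψ₃.IsRoot X₀ ↔
      3 * X₀ ^ 4 + 6 * (shortModel W c).a₄ * X₀ ^ 2 + 12 * (shortModel W c).a₆ * X₀ - (shortModel W c).a₄ ^ 2 = 0 := by
  have h1 : (shortModel W c).a₁ = 0 := rfl
  have h2 : (shortModel W c).a₂ = 0 := rfl
  have h3 : (shortModel W c).a₃ = 0 := rfl
  rw [Polynomial.IsRoot, WeierstrassCurve.Ψ₃]
  simp only [WeierstrassCurve.b₂, WeierstrassCurve.b₄, WeierstrassCurve.b₆, WeierstrassCurve.b₈, Polynomial.eval_add,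
    Polynomial.eval_mul, Polynomial.eval_pow, Polynomial.eval_C, Polynomial.eval_X,
    Polynomial.eval_ofNat, h1, h2, h3]
  constructor <;> intro h <;> linear_combination h

/-- The tangent slope scales like `y/x`: `α_{E_{W,c}}(X₀, Y₀) = c · α_{E♮}(X₀/c², Y₀/c³)`. [folklore] -/
theorem tangentSlope_eq_mul_intrinsic (W : WeierstrassCurve ℚ) {c : ℤ} (hc : c ≠ 0) (X₀ Y₀ : ℚ) :
    tangentSlope W c X₀ Y₀ = (c : ℚ) * tangentSlope W 1 (X₀ / (c : ℚ) ^ 2) (Y₀ / (c : ℚ) ^ 3) := by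
  have hcQ : (c : ℚ) ≠ 0 := Int.cast_ne_zero.mpr hc
  rcases eq_or_ne Y₀ 0 with hY | hY
  · simp [tangentSlope, hY]
  · simp only [tangentSlope, shortModel, Int.cast_one, one_pow, one_mul]
    field_simp

/-- `(X₀, Y₀)` is a point of order `3` of `E_{W,c}` iff `(X₀/c², Y₀/c³)` is one of `E♮ = E_{W,1}`. [folklore] -/
theorem isShortThreeTorsion_iff_intrinsic (W : WeierstrassCurve ℚ) [W.IsElliptic] {c : ℤ} (hc : c ≠ 0)
    (X₀ Y₀ : ℚ) : IsShortThreeTorsion W c X₀ Y₀ ↔ IsShortThreeTorsion W 1 (X₀ / (c : ℚ) ^ 2) (Y₀ / (c : ℚ) ^ 3) := by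
  have hcQ : (c : ℚ) ≠ 0 := Int.cast_ne_zero.mpr hc
  have hΔW : W.Δ ≠ 0 := W.isUnit_Δ.ne_zero
  have hΔc : (shortModel W c).toAffine.Δ ≠ 0 := by
    change (shortModel W c).Δ ≠ 0
    rw [shortModel_Δ]; exact mul_ne_zero (pow_ne_zero _ hcQ) hΔW
  have hΔ1 : (shortModel W 1).toAffine.Δ ≠ 0 := by
    change (shortModel W 1).Δ ≠ 0
    rw [shortModel_Δ]; push_cast; rw [one_pow, one_mul]; exact hΔW
  have ha₄c : (shortModel W c).a₄ = (c : ℚ) ^ 4 * (shortModel W 1).a₄ := by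
    simp only [shortModel, Int.cast_one, one_pow, one_mul]; ring
  have ha₆c : (shortModel W c).a₆ = (c : ℚ) ^ 6 * (shortModel W 1).a₆ := by
    simp only [shortModel, Int.cast_one, one_pow, one_mul]; ring
  have heq : (shortModel W c).toAffine.Equation X₀ Y₀ ↔
      (shortModel W 1).toAffine.Equation (X₀ / (c : ℚ) ^ 2) (Y₀ / (c : ℚ) ^ 3) := by
    rw [Affine.equation_iff, Affine.equation_iff]
    have h1 : (shortModel W c).a₁ = 0 := rfl
    have h2 : (shortModel W c).a₂ = 0 := rfl
    have h3 : (shortModel W c).a₃ = 0 := rfl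
    have h1' : (shortModel W 1).a₁ = 0 := rfl
    have h2' : (shortModel W 1).a₂ = 0 := rfl
    have h3' : (shortModel W 1).a₃ = 0 := rfl
    rw [h1, h2, h3, h1', h2', h3', ha₄c, ha₆c]
    constructor
    · intro h; field_simp; linear_combination h
    · intro h; field_simp at h; linear_combination h
  have hΨ : (shortModel W c).Ψ₃.IsRoot X₀ ↔ (shortModel W 1).Ψ₃.IsRoot (X₀ / (c : ℚ) ^ 2) := by
    rw [isRoot_Ψ₃_shortModel_iff, isRoot_Ψ₃_shortModel_iff, ha₄c, ha₆c]
    constructor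
    · intro h; field_simp; linear_combination h
    · intro h; field_simp at h; linear_combination h
  rw [IsShortThreeTorsion, IsShortThreeTorsion, ← (shortModel W c).toAffine.equation_iff_nonsingular_of_Δ_ne_zero hΔc,
    ← (shortModel W 1).toAffine.equation_iff_nonsingular_of_Δ_ne_zero hΔ1, heq, hΨ]

/-! ### §2 `Θ_T` on `E_{W,c}` is the intrinsic series `Θ♮` of `E♮` evaluated at `c·z` -/

/-- **`Θ_T(z) = Θ♮(c·z)`**: the tangent-line Kummer series of `(X₀, Y₀)` on `E_{W,c}` along `z` is the INTRINSIC series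
`Θ♮ := kummerCubeSeries W 1 (X₀/c²) (Y₀/c³) X` of `E♮` (in its formal parameter) substituted at `c·z`. [folklore] -/
theorem kummerCubeSeries_eq_subst_intrinsic (W : WeierstrassCurve ℚ) {c : ℤ} (hc : c ≠ 0) (X₀ Y₀ : ℚ) {z : ℚ⟦X⟧}
    (hz0 : constantCoeff z = 0) :
    kummerCubeSeries W c X₀ Y₀ z =
      (kummerCubeSeries W 1 (X₀ / (c : ℚ) ^ 2) (Y₀ / (c : ℚ) ^ 3) X).subst (C (c : ℚ) * z) := by
  have hcQ : (c : ℚ) ≠ 0 := Int.cast_ne_zero.mpr hc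
  have hcz0 : constantCoeff (C (c : ℚ) * z) = 0 := by rw [map_mul, hz0, mul_zero]
  have hcz : HasSubst (C (c : ℚ) * z) := HasSubst.of_constantCoeff_zero' hcz0
  have hY1 : (shortModel W 1).formalYMulCube = -(shortModel W 1).formalXMulSq := rfl
  have hYc : (shortModel W c).formalYMulCube = -(shortModel W c).formalXMulSq := rfl
  have hX : (shortModel W c).formalXMulSq.subst z = (shortModel W 1).formalXMulSq.subst (C (c : ℚ) * z) :=
    formalXMulSq_shortModel_subst W hc hz0
  have hzs : HasSubst z := HasSubst.of_constantCoeff_zero' hz0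
  set α₁ := tangentSlope W 1 (X₀ / (c : ℚ) ^ 2) (Y₀ / (c : ℚ) ^ 3) with hα₁
  set XS := (shortModel W 1).formalXMulSq with hXS
  have hL : kummerCubeSeries W c X₀ Y₀ z =
      -(XS.subst (C (c : ℚ) * z)) - Y₀ • z ^ 3 - ((c : ℚ) * α₁) • (XS.subst (C (c : ℚ) * z) * z - X₀ • z ^ 3) := by
    rw [kummerCubeSeries, hYc, tangentSlope_eq_mul_intrinsic W hc X₀ Y₀, ← hα₁, ← coe_substAlgHom hzs, map_neg,
      coe_substAlgHom hzs, hX]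
  have hR : (kummerCubeSeries W 1 (X₀ / (c : ℚ) ^ 2) (Y₀ / (c : ℚ) ^ 3) X).subst (C (c : ℚ) * z) =
      -(XS.subst (C (c : ℚ) * z)) - (Y₀ / (c : ℚ) ^ 3) • (C (c : ℚ) * z) ^ 3
        - α₁ • (XS.subst (C (c : ℚ) * z) * (C (c : ℚ) * z) - (X₀ / (c : ℚ) ^ 2) • (C (c : ℚ) * z) ^ 3) := by
    rw [kummerCubeSeries, hY1, X_subst, X_subst, ← hα₁, ← hXS, ← coe_substAlgHom hcz]
    simp only [map_sub, map_neg, map_mul, map_pow, map_smul, substAlgHom_X, coe_substAlgHom]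
  rw [hL, hR, smul_eq_C_mul, smul_eq_C_mul, smul_eq_C_mul, smul_eq_C_mul, smul_eq_C_mul, smul_eq_C_mul]
  have e1 : (C (Y₀ / (c : ℚ) ^ 3) : ℚ⟦X⟧) * C (c : ℚ) ^ 3 = C Y₀ := by
    rw [← map_pow, ← map_mul]; congr 1; field_simp
  have e2 : (C ((c : ℚ) * α₁) : ℚ⟦X⟧) = C (c : ℚ) * C α₁ := by rw [map_mul]
  have e3 : (C (X₀ / (c : ℚ) ^ 2) : ℚ⟦X⟧) * C (c : ℚ) ^ 3 = C X₀ * C (c : ℚ) := by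
    rw [← map_pow, ← map_mul, ← map_mul]; congr 1; field_simp
  linear_combination (z ^ 3) * e1 - (XS.subst (C (c : ℚ) * z) * z - C X₀ * z ^ 3) * e2
    - (C α₁ * z ^ 3) * e3

/-! ### §3 The cube condition in `Frac ℤ₃⟦q⟧` is invariant under an integral substitution with unit linear term -/

/-- **Substitution invariance of `IsThreeAdicFracCube`**: if `D` is the image of `Dz ∈ qℤ₃⟦q⟧` with UNIT linear
coefficient, then `Φ(D)` is a cube in `Frac ℤ₃⟦q⟧` iff `Φ` is (substitute `Dz`, resp. `substInvOfIsUnit Dz`). [folklore] -/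
theorem isThreeAdicFracCube_subst_iff {Φ D : ℚ⟦X⟧} {Dz : ℤ_[3]⟦X⟧}
    (hD : PowerSeries.map (Rat.castHom ℚ_[3]) D = PowerSeries.map PadicInt.Coe.ringHom Dz)
    (hDz0 : constantCoeff Dz = 0) (hDz1 : IsUnit (coeff 1 Dz)) :
    IsThreeAdicFracCube (Φ.subst D) ↔ IsThreeAdicFracCube Φ := by
  have hκinj : Function.Injective (PowerSeries.map (PadicInt.Coe.ringHom (p := 3))) :=
    PowerSeries.map_injective _ (fun x y h => PadicInt.ext h)
  have hD0 : constantCoeff D = 0 := by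
    have h := congrArg (coeff 0) hD
    rw [coeff_map, coeff_map, coeff_zero_eq_constantCoeff, coeff_zero_eq_constantCoeff, hDz0, map_zero,
      _root_.map_eq_zero] at h
    exact h
  have hDs : HasSubst D := HasSubst.of_constantCoeff_zero' hD0
  have hDzs : HasSubst Dz := HasSubst.of_constantCoeff_zero' hDz0
  have hκDz0 : constantCoeff (PowerSeries.map (PadicInt.Coe.ringHom (p := 3)) Dz) = 0 := by
    rw [← coeff_zero_eq_constantCoeff, coeff_map, coeff_zero_eq_constantCoeff, hDz0, map_zero]
  have hκDzs : HasSubst (PowerSeries.map (PadicInt.Coe.ringHom (p := 3)) Dz) := HasSubst.of_constantCoeff_zero' hκDz0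
  set I : ℤ_[3]⟦X⟧ := substInvOfIsUnit Dz hDz1 with hI
  have hIs : HasSubst I := HasSubst.substInvOfIsUnit Dz hDz1
  have hI0 : constantCoeff I = 0 := constantCoeff_substInvOfIsUnit Dz hDz1
  have hκI0 : constantCoeff (PowerSeries.map (PadicInt.Coe.ringHom (p := 3)) I) = 0 := by
    rw [← coeff_zero_eq_constantCoeff, coeff_map, coeff_zero_eq_constantCoeff, hI0, map_zero]
  have hκIs : HasSubst (PowerSeries.map (PadicInt.Coe.ringHom (p := 3)) I) := HasSubst.of_constantCoeff_zero' hκI0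
  have hDI : Dz.subst I = X := subst_substInvOfIsUnit_right Dz hDz0 hDz1
  have hID : I.subst Dz = X := subst_substInvOfIsUnit_left Dz hDz0 hDz1
  -- `Φ(D)` read in `ℚ₃⟦q⟧` is `Φ` substituted at `Dz`
  have key : PowerSeries.map (Rat.castHom ℚ_[3]) (Φ.subst D) =
      (PowerSeries.map (Rat.castHom ℚ_[3]) Φ).subst (PowerSeries.map (PadicInt.Coe.ringHom (p := 3)) Dz) := by
    rw [map_subst_apply hDs, hD]
  -- non-vanishing is preserved by the invertible substitutions
  have hne1 : ∀ B : ℤ_[3]⟦X⟧, B ≠ 0 → B.subst Dz ≠ 0 := fun B hB h0 => hB <| by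
    have h := congrArg (PowerSeries.subst I) h0
    rw [subst_comp_subst_apply hDzs hIs, hDI, X_subst] at h
    rw [h, ← coe_substAlgHom hIs, map_zero]
  have hne2 : ∀ B : ℤ_[3]⟦X⟧, B ≠ 0 → B.subst I ≠ 0 := fun B hB h0 => hB <| by
    have h := congrArg (PowerSeries.subst Dz) h0
    rw [subst_comp_subst_apply hIs hDzs, hID, X_subst] at h
    rw [h, ← coe_substAlgHom hDzs, map_zero]
  constructor
  · rintro ⟨A, B, hB, h⟩
    refine ⟨A.subst I, B.subst I, hne2 B hB, ?_⟩
    have h' := congrArg (PowerSeries.subst (PowerSeries.map (PadicInt.Coe.ringHom (p := 3)) I)) h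
    rw [← coe_substAlgHom hκIs, map_mul, map_pow, map_pow, coe_substAlgHom hκIs, key,
      subst_comp_subst_apply hκDzs hκIs, ← map_subst_apply hIs, hDI, PowerSeries.map_X, X_subst,
      ← map_subst_apply hIs, ← map_subst_apply hIs] at h'
    exact h'
  · rintro ⟨A, B, hB, h⟩
    refine ⟨A.subst Dz, B.subst Dz, hne1 B hB, ?_⟩
    have h' := congrArg (PowerSeries.subst (PowerSeries.map (PadicInt.Coe.ringHom (p := 3)) Dz)) h
    rw [← coe_substAlgHom hκDzs, map_mul, map_pow, map_pow, coe_substAlgHom hκDzs, ← key,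
      ← map_subst_apply hDzs, ← map_subst_apply hDzs] at h'
    exact h'

/-! ### §4 At `3 ∤ c` the scaled germ `c·z` is a `3`-integral series with UNIT linear coefficient -/

/-- **The scaled germ at `3 ∤ c`.**  For globally minimal `W` with an `X₀(N)`-datum `D`, `9 ∣ N`, and the germ `z`
(`log_{E_{W,c}}(z) = Σ aₙqⁿ/n`, `c = D.c`): `c·z = exp_{E♮}(c·L)`, `L = Σ aₙqⁿ/n ∈ ℤ₃⟦q⟧` (`a_{3m} = 0`), `exp_{E♮} ∈ ℤ₃⟦T⟧`
(Honda at the additive prime, p3's `exists_padicInt_shortModel_three`); so `c·z ∈ qℤ₃⟦q⟧` with linear coefficient `c`,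
a `3`-adic unit when `3 ∤ c`. [cite: Honda1970, Thm. 2 (p. 223)] -/
theorem exists_padicInt_scaled_germ_of_not_three_dvd (W : WeierstrassCurve ℚ) [W.IsElliptic]
    [W.IsGloballyMinimal] {N : ℕ} [NeZero N] (D : ModularParametrizationData W N) (a : ℕ → ℤ)
    (ha : ∀ n, (a n : ℂ) = cuspCoeff D.f n) (h9 : 9 ∣ N) {z : ℚ⟦X⟧} (hz : IsParamGerm W D.c a z)
    (h3 : ¬ (3 : ℤ) ∣ D.c) :
    ∃ Dz : ℤ_[3]⟦X⟧, PowerSeries.map (Rat.castHom ℚ_[3]) (C (D.c : ℚ) * z) =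
      PowerSeries.map PadicInt.Coe.ringHom Dz ∧ constantCoeff Dz = 0 ∧ IsUnit (coeff 1 Dz) := by
  obtain ⟨hz0, hlog⟩ := hz
  have hc0 : D.c ≠ 0 := D.maninConstant_ne_zero_holds
  -- arithmetic at `3`; the `3`-integral model `E♮`
  obtain ⟨ha3, hN3⟩ := lFunction_three_eq_zero_of_nine_dvd W D.isNewformOf h9
  obtain ⟨hΔ3, hc₄3⟩ := three_dvd_Δ_and_c₄_of_hasAdditiveReductionAt W
    (hasAdditiveReductionAt_three_of_lFunction_three_eq_zero W ha3 hN3)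
  obtain ⟨V, -, -, -, hVE, -, -, hexpint⟩ := exists_padicInt_shortModel_three W hΔ3 hc₄3
  have han : ∀ n, a n = W.LFunction n := fun n => by
    have h := ha n; rw [D.isNewformOf.2 n] at h; exact_mod_cast h
  have hrat : ∀ q : ℚ, algebraMap ℚ ℚ_[3] q = (q : ℚ_[3]) := fun q => by rw [eq_ratCast]
  -- the germ read on `E♮ ⊗ ℚ₃`
  set ι : ℚ⟦X⟧ →+* ℚ_[3]⟦X⟧ := PowerSeries.map (algebraMap ℚ ℚ_[3]) with hι
  set z₃ : ℚ_[3]⟦X⟧ := ι z with hz₃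
  set L₃ : ℚ_[3]⟦X⟧ := ι (lSeriesLog a) with hL₃
  set D₃ : ℚ_[3]⟦X⟧ := C ((D.c : ℚ) : ℚ_[3]) * z₃ with hD₃
  have hcz0 : constantCoeff (C (D.c : ℚ) * z) = 0 := by rw [map_mul, hz0, mul_zero]
  have hlog1 : (shortModel W 1).formalLog.subst (C (D.c : ℚ) * z) = C (D.c : ℚ) * lSeriesLog a := by
    have h := formalLog_shortModel_subst W hc0 hz0
    rw [hlog] at h
    have hcc : (C (D.c : ℚ) : ℚ⟦X⟧) * C (D.c : ℚ)⁻¹ = 1 := by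
      rw [← map_mul, mul_inv_cancel₀ (Int.cast_ne_zero.mpr hc0), map_one]
    calc (shortModel W 1).formalLog.subst (C (D.c : ℚ) * z)
        = C (D.c : ℚ) * C (D.c : ℚ)⁻¹ * (shortModel W 1).formalLog.subst (C (D.c : ℚ) * z) := by
          rw [hcc, one_mul]
      _ = C (D.c : ℚ) * lSeriesLog a := by rw [mul_assoc, ← h]
  have hz₃0 : constantCoeff z₃ = 0 := by
    rw [hz₃, hι, ← coeff_zero_eq_constantCoeff, coeff_map, coeff_zero_eq_constantCoeff, hz0, map_zero]
  have hD₃0 : constantCoeff D₃ = 0 := by rw [hD₃, map_mul, hz₃0, mul_zero]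
  have hL₃0 : constantCoeff L₃ = 0 := by
    rw [hL₃, hι, ← coeff_zero_eq_constantCoeff, coeff_map, lSeriesLog, coeff_mk]; simp
  have hlog2 : (V.map PadicInt.Coe.ringHom).formalLog.subst D₃ = C ((D.c : ℚ) : ℚ_[3]) * L₃ := by
    have h := congrArg ι hlog1
    rw [hι, map_subst_apply (HasSubst.of_constantCoeff_zero' hcz0), map_formalLog, ← hVE, map_mul,
      map_C, map_mul, map_C, hrat] at h
    exact h
  -- the linear coefficient: `z = q + ⋯`, so `D₃ = c·q + ⋯`
  have hz1 : coeff 1 z = 1 := by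
    have h := congrArg (coeff 1) hlog
    rw [coeff_one_subst_eq_mul _ hz0, coeff_one_formalLog, one_mul, lSeriesLog, coeff_mk, han 1,
      W.isMultiplicative_LFunction.map_one] at h
    simpa using h
  have hD₃1 : coeff 1 D₃ = ((D.c : ℚ) : ℚ_[3]) := by
    rw [hD₃, coeff_C_mul, hz₃, hι, coeff_map, hz1, map_one, mul_one]
  -- integrality: `L₃ ∈ ℤ₃⟦q⟧` (`a_{3m} = 0`), `D₃ = exp_{E♮}(c L₃) ∈ ℤ₃⟦q⟧`
  have hL₃int : IsPadicInt L₃ := by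
    rw [isPadicInt_iff_coeff]
    intro n
    rw [hL₃, hι, coeff_map, lSeriesLog, coeff_mk, hrat]
    by_cases hn0 : n = 0
    · subst hn0; simp
    by_cases h3n : 3 ∣ n
    · rw [han n, lFunction_eq_zero_of_three_dvd W ha3 hN3 hn0 h3n]
      simp
    · push_cast
      rw [div_eq_mul_inv, norm_mul, padic_norm_inv_natCast_of_not_dvd h3n, mul_one]
      exact Padic.norm_int_le_one _
  have hu0 : constantCoeff (C ((D.c : ℚ) : ℚ_[3]) * L₃) = 0 := by rw [map_mul, hL₃0, mul_zero]
  have hDexp : D₃ = (V.map PadicInt.Coe.ringHom).formalExp.subst (C ((D.c : ℚ) : ℚ_[3]) * L₃) := by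
    rw [← hlog2, formalExp_subst_formalLog_subst _ hD₃0]
  have hcint : IsPadicInt (C ((D.c : ℚ) : ℚ_[3]) : ℚ_[3]⟦X⟧) := by
    rw [Rat.cast_intCast]
    exact IsPadicInt.powerSeries_C (Padic.norm_int_le_one _)
  have hDint : IsPadicInt D₃ := by
    rw [hDexp]
    exact hexpint.powerSeries_subst (hcint.mul hL₃int) (HasSubst.of_constantCoeff_zero' hu0)
  obtain ⟨Dz, hDz⟩ := isPadicInt_iff_exists_powerSeries_map.mp hDint
  have hDz0 : constantCoeff Dz = 0 := by
    have h : (PadicInt.Coe.ringHom (p := 3)) (constantCoeff Dz) = 0 := by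
      rw [← coeff_zero_eq_constantCoeff_apply, ← coeff_map, hDz, coeff_zero_eq_constantCoeff_apply, hD₃0]
    exact PadicInt.coe_eq_zero.mp h
  have hDz1 : IsUnit (coeff 1 Dz) := by
    have h : ((coeff 1 Dz : ℤ_[3]) : ℚ_[3]) = ((D.c : ℤ) : ℚ_[3]) := by
      have h' : (PadicInt.Coe.ringHom (p := 3)) (coeff 1 Dz) = coeff 1 D₃ := by rw [← coeff_map, hDz]
      rw [hD₃1, Rat.cast_intCast] at h'
      exact h'
    rw [PadicInt.isUnit_iff, PadicInt.norm_def, h]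
    have hle : ‖((D.c : ℤ) : ℚ_[3])‖ ≤ 1 := Padic.norm_int_le_one _
    have hnlt : ¬ ‖((D.c : ℤ) : ℚ_[3])‖ < 1 := by
      rw [Padic.norm_intCast_lt_one_iff]; exact_mod_cast h3
    exact le_antisymm hle (not_lt.mp hnlt)
  refine ⟨Dz, ?_, hDz0, hDz1⟩
  rw [hDz, Subsingleton.elim (Rat.castHom ℚ_[3]) (algebraMap ℚ ℚ_[3])]
  change ι (C (D.c : ℚ) * z) = D₃
  rw [hD₃, hz₃, map_mul, hι, map_C, hrat]

/-! ### §5 THE INVARIANCE: at `3 ∤ c`, «`Θ_T` is a `3`-adic cube» is the intrinsic `3`-blindness of `T` -/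

/-- **`c`-invariance of the cube condition at `3 ∤ c`.**  For globally minimal `W` with an `X₀(N)`-datum `D`, `9 ∣ N`,
the germ `z` and `3 ∤ c = D.c`: `Θ_T` of `T = (X₀, Y₀)` on `E_{W,c}` is a cube in `Frac ℤ₃⟦q⟧` iff the INTRINSIC series
`Θ♮ = kummerCubeSeries W 1 (X₀/c²) (Y₀/c³) X` of `T♮` on `E♮ = E_{W,1}` (formal parameter) is a cube in `Frac ℤ₃⟦t⟧` —
«`T` is `3`-BLIND», a `c`-free property of `(W, T)`. [cite: Honda1970, Thm. 2 (p. 223)] -/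
theorem isThreeAdicFracCube_kummerCubeSeries_iff_intrinsic (W : WeierstrassCurve ℚ) [W.IsElliptic]
    [W.IsGloballyMinimal] {N : ℕ} [NeZero N] (D : ModularParametrizationData W N) (a : ℕ → ℤ)
    (ha : ∀ n, (a n : ℂ) = cuspCoeff D.f n) (h9 : 9 ∣ N) (X₀ Y₀ : ℚ) {z : ℚ⟦X⟧} (hz : IsParamGerm W D.c a z)
    (h3 : ¬ (3 : ℤ) ∣ D.c) :
    IsThreeAdicFracCube (kummerCubeSeries W D.c X₀ Y₀ z) ↔
      IsThreeAdicFracCube (kummerCubeSeries W 1 (X₀ / (D.c : ℚ) ^ 2) (Y₀ / (D.c : ℚ) ^ 3) X) := by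
  have hc0 : D.c ≠ 0 := D.maninConstant_ne_zero_holds
  obtain ⟨Dz, hD, hDz0, hDz1⟩ := exists_padicInt_scaled_germ_of_not_three_dvd W D a ha h9 hz h3
  rw [kummerCubeSeries_eq_subst_intrinsic W hc0 X₀ Y₀ hz.1]
  exact isThreeAdicFracCube_subst_iff hD hDz0 hDz1

/-! ### §6 Consequences for stub 4 of `kato_shift_three`: LAW₃ = NB₃ ∧ (C3 on the locus), modulo K_geo₃ -/

/-- **HONESTY of LAW₃ at a datum (the `p = 3` twin of p1-g4's `cuspidalKummerOddExponent_of_maninOddOfReducibleAtFour`).**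
If `3 ∤ c` and `T` is NOT `3`-blind, then every cuspidal Kummer cube representative of `Θ_T` has an `η`-exponent
`≢ 0 (mod 3)` — LAW₃'s conclusion holds at that datum with no further input. [folklore] -/
theorem exists_not_three_dvd_of_not_threeBlind (W : WeierstrassCurve ℚ) [W.IsElliptic] [W.IsGloballyMinimal]
    {N : ℕ} [NeZero N] (D : ModularParametrizationData W N) (a : ℕ → ℤ) (ha : ∀ n, (a n : ℂ) = cuspCoeff D.f n)
    (h9 : 9 ∣ N) (X₀ Y₀ : ℚ) {z : ℚ⟦X⟧} (hz : IsParamGerm W D.c a z) (h3 : ¬ (3 : ℤ) ∣ D.c)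
    (hnb : ¬ IsThreeAdicFracCube (kummerCubeSeries W 1 (X₀ / (D.c : ℚ) ^ 2) (Y₀ / (D.c : ℚ) ^ 3) X))
    {r : ℕ → ℤ} {g A B : ℤ⟦X⟧} (hrep : IsCuspidalKummerCubeRep N (kummerCubeSeries W D.c X₀ Y₀ z) r g A B) :
    ∃ δ ∈ N.divisors, ¬ (3 : ℤ) ∣ r δ :=
  exists_not_three_dvd_of_not_isThreeAdicFracCube W D.c X₀ Y₀ hz.1
    (fun h => hnb ((isThreeAdicFracCube_kummerCubeSeries_iff_intrinsic W D a ha h9 X₀ Y₀ hz h3).mp h)) hrep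

/-- **A `3`-blind point defeats LAW₃ at every datum with `3 ∤ c`** (all exponents `≡ 0 (mod 3)`). [folklore] -/
theorem forall_three_dvd_of_threeBlind (W : WeierstrassCurve ℚ) [W.IsElliptic] [W.IsGloballyMinimal]
    {N : ℕ} [NeZero N] (D : ModularParametrizationData W N) (a : ℕ → ℤ) (ha : ∀ n, (a n : ℂ) = cuspCoeff D.f n)
    (h9 : 9 ∣ N) (X₀ Y₀ : ℚ) {z : ℚ⟦X⟧} (hz : IsParamGerm W D.c a z) (h3 : ¬ (3 : ℤ) ∣ D.c)
    (hb : IsThreeAdicFracCube (kummerCubeSeries W 1 (X₀ / (D.c : ℚ) ^ 2) (Y₀ / (D.c : ℚ) ^ 3) X))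
    {r : ℕ → ℤ} {g A B : ℤ⟦X⟧} (hrep : IsCuspidalKummerCubeRep N (kummerCubeSeries W D.c X₀ Y₀ z) r g A B) :
    ∀ δ ∈ N.divisors, (3 : ℤ) ∣ r δ := by
  have hΘ0 : constantCoeff (kummerCubeSeries W D.c X₀ Y₀ z) ≠ 0 := by
    rw [constantCoeff_kummerCubeSeries W D.c X₀ Y₀ hz.1]; norm_num
  exact forall_three_dvd_of_isThreeAdicFracCube hΘ0
    ((isThreeAdicFracCube_kummerCubeSeries_iff_intrinsic W D a ha h9 X₀ Y₀ hz h3).mpr hb) hrep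

/-- **LAW₃ ⟸ NB₃ ∧ (C3 on the rational-`3`-torsion locus)** — the honest content of stub 4.  NB₃ (inline, `c`-free):
no `X₀(N)`-optimal globally minimal `W` (lattice clause) with `9 ∣ N` carries a `3`-BLIND rational point of order `3` on
`E♮ = E_{W,1}`; C3 on the locus (inline): such a `W` with a rational point of order `3` on `E_{W,c}` has `3 ∤ c`.  Given
both, LAW₃ holds (at `3 ∣ c` vacuously, at `3 ∤ c` by §5 and the cube criterion).  CONDITIONAL edge. [folklore] -/
theorem cuspidalKummerCubeExponentLaw_of_noBlind_of_locus
    (hNB : ∀ (W : WeierstrassCurve ℚ) [W.IsElliptic] [W.IsGloballyMinimal] {N : ℕ} [NeZero N]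
      (D : ModularParametrizationData W N),
      (∀ z ∈ D.L.lattice, ∃ w ∈ periodLattice D.f, z = D.c * w) → 9 ∣ N →
      ∀ X₁ Y₁ : ℚ, IsShortThreeTorsion W 1 X₁ Y₁ → ¬ IsThreeAdicFracCube (kummerCubeSeries W 1 X₁ Y₁ X))
    (hC3 : ∀ (W : WeierstrassCurve ℚ) [W.IsElliptic] [W.IsGloballyMinimal] {N : ℕ} [NeZero N]
      (D : ModularParametrizationData W N),
      (∀ z ∈ D.L.lattice, ∃ w ∈ periodLattice D.f, z = D.c * w) → 9 ∣ N →
      ∀ X₀ Y₀ : ℚ, IsShortThreeTorsion W D.c X₀ Y₀ → ¬ (3 : ℤ) ∣ D.c) :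
    CuspidalKummerCubeExponentLaw := by
  refine cuspidalKummerCubeExponentLaw_of_noCube ?_
  intro W _ _ N _ D a ha h9 hL X₀ Y₀ hT z hz
  have hc0 : D.c ≠ 0 := D.maninConstant_ne_zero_holds
  have h3 : ¬ (3 : ℤ) ∣ D.c := hC3 W D hL h9 X₀ Y₀ hT
  have hT1 : IsShortThreeTorsion W 1 (X₀ / (D.c : ℚ) ^ 2) (Y₀ / (D.c : ℚ) ^ 3) :=
    (isShortThreeTorsion_iff_intrinsic W hc0 X₀ Y₀).mp hT
  rw [isThreeAdicFracCube_kummerCubeSeries_iff_intrinsic W D a ha h9 X₀ Y₀ hz h3]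
  exact hNB W D hL h9 _ _ hT1

/-- **LAW₃ ∧ K_geo₃ ⟹ NB₃**: granting LAW₃ and E-an-57 (a cuspidal cube representative exists), no `X₀(N)`-optimal
`W` with `9 ∣ N` carries a `3`-blind rational point of order `3` — the `c`-free OPTIMALITY law hidden in stub 4
(at `3 ∤ c` by the invariance; at `3 ∣ c` E-an-55 already contradicts NOCUBE₃).  CONDITIONAL edge. [folklore] -/
theorem noBlind_of_cuspidalKummerCubeExponentLaw_of_representative (hLaw : CuspidalKummerCubeExponentLaw)
    (h57 : CuspidalKummerCubeRepresentativeAtNine) :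
    ∀ (W : WeierstrassCurve ℚ) [W.IsElliptic] [W.IsGloballyMinimal] {N : ℕ} [NeZero N]
      (D : ModularParametrizationData W N),
      (∀ z ∈ D.L.lattice, ∃ w ∈ periodLattice D.f, z = D.c * w) → 9 ∣ N →
      ∀ X₁ Y₁ : ℚ, IsShortThreeTorsion W 1 X₁ Y₁ → ¬ IsThreeAdicFracCube (kummerCubeSeries W 1 X₁ Y₁ X) := by
  intro W _ _ N _ D hL h9 X₁ Y₁ hT1 hb
  have hc0 : D.c ≠ 0 := D.maninConstant_ne_zero_holds
  have hcQ : (D.c : ℚ) ≠ 0 := Int.cast_ne_zero.mpr hc0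
  set a : ℕ → ℤ := fun n => W.LFunction n with ha_def
  have ha : ∀ n, (a n : ℂ) = cuspCoeff D.f n := fun n => (D.isNewformOf.2 n).symm
  obtain ⟨z, hz⟩ := exists_isParamGerm W D.c a
  -- the point `T = (c²X₁, c³Y₁)` of `E_{W,c}`
  set X₀ : ℚ := (D.c : ℚ) ^ 2 * X₁ with hX₀
  set Y₀ : ℚ := (D.c : ℚ) ^ 3 * Y₁ with hY₀
  have hX₁ : X₀ / (D.c : ℚ) ^ 2 = X₁ := by rw [hX₀]; field_simp
  have hY₁ : Y₀ / (D.c : ℚ) ^ 3 = Y₁ := by rw [hY₀]; field_simp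
  have hT : IsShortThreeTorsion W D.c X₀ Y₀ := by
    rw [isShortThreeTorsion_iff_intrinsic W hc0 X₀ Y₀, hX₁, hY₁]; exact hT1
  have hNC := noCube_of_cuspidalKummerCubeExponentLaw_of_representative hLaw h57 W D a ha h9 hL X₀ Y₀ hT z hz
  by_cases h3 : (3 : ℤ) ∣ D.c
  · exact hNC (ManinThreeKummerCube_holds W D a ha h9 X₀ Y₀ hT z hz h3)
  · rw [isThreeAdicFracCube_kummerCubeSeries_iff_intrinsic W D a ha h9 X₀ Y₀ hz h3, hX₁, hY₁] at hNC
    exact hNC hb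

end Summit.BirchSwinnertonDyer.BirchSwinnertonDyer.Theorems.ManinLocalTwoThree

end
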